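import Literature.Probability.RandomPlanarGeometry.HexSAWBridges
import HarnessLib

/-!
# Irreducible bridges of the hexagonal-lattice strip and Kesten's concatenation (renewal) structure

Topic `Literature/Probability/RandomPlanarGeometry`.  Sources: H. Kesten, *On the number of self-avoiding
walks*, J. Math. Phys. 4 (1963) 960–969, §4 (bridges, irreducible bridges, the renewal identity); N. Madras,
G. Slade, *The Self-Avoiding Walk* (1993), §1.2 (concatenation of bridges, (1.2.15)) and §4.2 (break points,
irreducible bridges, Definition 4.2.1, the renewal equation (4.2.2)); for the strip `S_{T,L}` of the hexagonal
lattice, its bridges `a → β` and their partition function `B_{T,L}(x)`: H. Duminil-Copin, S. Smirnov, Ann. of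
Math. 175 (2012), §3 (`HexSAWStrip.lean`, `HexSAWLowerBound.lean`: `HV.bridgeLists`, `HV.stripB_eq_sum_bridgeLists`).

A bridge of width `T` of the strip (an element `l` of `HV.bridgeLists T L`: a self-avoiding walk from the origin
`O`, levels in `[0, 2T-1]`, ending on the top level `2T-1`) has a **renewal (break) level** `t`, `1 ≤ t < T`, if
after its first visit to a level `≥ 2t` it never returns to a level `< 2t` (Madras–Slade's break points, in the
level coordinate of Duminil-Copin–Smirnov); it is **irreducible** if it has none.  This file sets up:

* `HV.rIdx`, `HV.low`, `HV.high` — the first index at level `≥ 2t`, the pieces before / from it; the junction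
  edge of a renewal is the vertical edge from level `2t-1` to level `2t` (`HV.junction`);
* `HV.IsRenewalAt`, `HV.IsIrred`, `HV.irrLists T L`, `HV.stripI T L x` (`= Σ_{irreducible bridges} x^{ℓ}`),
  `HV.firstRen` (the first renewal level, `T` for an irreducible bridge); `HV.isRenewalAt_append_iff`;
* the two pieces of a bridge at a renewal level are bridges: `HV.low_mem_bridgeLists` (width `t`, irreducible at
  the first renewal level: `HV.isIrred_low`), `HV.highStd_mem_bridgeLists` (width `T-t`, after translation to the
  origin, inside `S_{T-t,2L+T}`);
* `HV.brConcat` — Kesten's CONCATENATION of a bridge of width `t` with a (translated) bridge of width `T - t`: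
  a bridge of width `T` of `S_{T, 2L+T}` (`brConcat_mem_bridgeLists`) with `low_brConcat`, `high_brConcat`, `isRenewalAt_brConcat`,
  first renewal level `t` when the first factor is irreducible (`firstRen_brConcat`), injective (`brConcat_injOn`);
* **`HV.sum_brConcat_le_stripB`** — the finite-volume lower renewal inequality
  `I_{T,L}(x) + Σ_{1 ≤ t < T} I_{t,L}(x) · B_{T-t,L}(x) ≤ B_{T,2L+T}(x)` (`x ≥ 0`), and the decomposition of
  `B_{T,L}` along the first renewal level (`stripB_eq_sum_firstRen`).

The cutting inequality `B_{T,L} ≤ I_{T,L} + Σ_{t<T} I_{t,L} B_{T-t,2L+T}`, the limits `L → ∞` (the renewal equation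
`B_T = Σ_{t=1}^{T} I_t B_{T-t}` at `x_c`) and Kesten's identity `Σ_T I_T(x_c) = 1` are in `HexSAWKestenRenewal.lean`.
-/

noncomputable section

open Finset Literature.Probability.LatticeModels

namespace Literature.Probability.RandomPlanarGeometry.SAW

namespace HV

/-! ### The first visit to level `≥ 2t`, and the two pieces -/

/-- The index of the first vertex of `l` on a level `≥ 2t` (`= l.length` if there is none).
[cite: MadrasSlade1993, §4.2 (break points)] -/
def rIdx (t : ℕ) (l : List HV) : ℕ := l.findIdx fun v => decide (2 * (t : ℤ) ≤ lev v)

/-- The initial piece of `l` strictly below level `2t`. [cite: MadrasSlade1993, §4.2] -/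
def low (t : ℕ) (l : List HV) : List HV := l.take (rIdx t l)

/-- The final piece of `l`, from its first visit to a level `≥ 2t` on. [cite: MadrasSlade1993, §4.2] -/
def high (t : ℕ) (l : List HV) : List HV := l.drop (rIdx t l)

/-- `l = low ++ high`. [folklore] -/
theorem low_append_high (t : ℕ) (l : List HV) : low t l ++ high t l = l := List.take_append_drop _ _

/-- `rIdx ≤ length`. [folklore] -/
theorem rIdx_le_length (t : ℕ) (l : List HV) : rIdx t l ≤ l.length := List.findIdx_le_length

/-- Vertices of the low piece lie strictly below level `2t`. [cite: MadrasSlade1993, §4.2] -/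
theorem lev_lt_of_mem_low {t : ℕ} {l : List HV} {v : HV} (hv : v ∈ low t l) : lev v < 2 * (t : ℤ) := by
  rw [low] at hv
  obtain ⟨i, hi, rfl⟩ := List.getElem_of_mem hv
  rw [List.length_take] at hi
  have hil : i < rIdx t l := lt_of_lt_of_le hi (min_le_left _ _)
  have h := List.not_of_lt_findIdx (p := fun v => decide (2 * (t : ℤ) ≤ lev v)) (xs := l) hil
  simp only [decide_eq_false_iff_not, not_le] at h
  simp only [List.getElem_take]
  omega

/-- If the high piece is nonempty, its first vertex is on a level `≥ 2t`. [cite: MadrasSlade1993, §4.2] -/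
theorem le_lev_head_high {t : ℕ} {l : List HV} (h : rIdx t l < l.length) :
    2 * (t : ℤ) ≤ lev (l[rIdx t l]'h) := by
  have := List.findIdx_getElem (p := fun v => decide (2 * (t : ℤ) ≤ lev v)) (xs := l) (w := h)
  simp only [decide_eq_true_eq] at this
  exact this

/-- The high piece is nonempty iff `rIdx < length`. [folklore] -/
theorem high_ne_nil_iff {t : ℕ} {l : List HV} : high t l ≠ [] ↔ rIdx t l < l.length := by
  rw [high, ne_eq, List.drop_eq_nil_iff, not_le]

/-- The first vertex of the high piece. [folklore] -/
theorem head_high {t : ℕ} {l : List HV} (h : high t l ≠ []) :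
    (high t l).head h = l[rIdx t l]'(high_ne_nil_iff.1 h) :=
  List.head_drop h

/-- The last vertex of a nonempty high piece is the last vertex of the list. [folklore] -/
theorem getLast_high {t : ℕ} {l : List HV} (h : high t l ≠ []) :
    (high t l).getLast h = l.getLast (List.ne_nil_of_drop_ne_nil h) :=
  List.getLast_drop h

/-- `t` is a **renewal (break) level** of `l`: `l` visits a level `≥ 2t`, and from its first such visit
on it stays on levels `≥ 2t`. [cite: MadrasSlade1993, Definition 4.2.1 / (4.2.1)] -/
def IsRenewalAt (t : ℕ) (l : List HV) : Prop :=
  rIdx t l < l.length ∧ ∀ v ∈ high t l, 2 * (t : ℤ) ≤ lev v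

/-- Decidability of being a renewal level. [folklore] -/
instance (t : ℕ) (l : List HV) : Decidable (IsRenewalAt t l) := by
  unfold IsRenewalAt; infer_instance

/-- **Irreducible** bridge of width `T`: no renewal level `t` with `1 ≤ t < T`.
[cite: MadrasSlade1993, Definition 4.2.1] -/
def IsIrred (T : ℕ) (l : List HV) : Prop := ∀ t : ℕ, 1 ≤ t → t < T → ¬ IsRenewalAt t l

/-- Decidability of irreducibility. [folklore] -/
instance (T : ℕ) (l : List HV) : Decidable (IsIrred T l) := by
  unfold IsIrred
  exact decidable_of_iff (∀ t ∈ range T, 1 ≤ t → ¬ IsRenewalAt t l)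
    ⟨fun h t h1 h2 => h t (mem_range.2 h2) h1, fun h t ht h1 => h t h1 (mem_range.1 ht)⟩

/-- The irreducible bridges of width `T` of `S_{T,L}`. [cite: Kesten1963SAW, §4] -/
def irrLists (T L : ℕ) : Finset (List HV) := (bridgeLists T L).filter (IsIrred T)

/-- `I_{T,L}(x) = Σ_{irreducible bridges of S_{T,L}} x^{ℓ}`. [cite: Kesten1963SAW, §4] -/
def stripI (T L : ℕ) (x : ℝ) : ℝ := ∑ l ∈ irrLists T L, x ^ l.length

/-- `I_{T,L} ≥ 0` for `x ≥ 0`. [folklore] -/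
theorem stripI_nonneg (T L : ℕ) {x : ℝ} (hx : 0 ≤ x) : 0 ≤ stripI T L x :=
  sum_nonneg fun _ _ => pow_nonneg hx _

/-- `I_{T,L} ≤ B_{T,L}` (`T ≥ 1`, `x ≥ 0`). [cite: Kesten1963SAW, §4] -/
theorem stripI_le_stripB {T : ℕ} (hT : 1 ≤ T) (L : ℕ) {x : ℝ} (hx : 0 ≤ x) :
    stripI T L x ≤ stripB T L x := by
  rw [stripI, stripB_eq_sum_bridgeLists hT]
  exact sum_le_sum_of_subset_of_nonneg (filter_subset _ _) fun _ _ _ => pow_nonneg hx _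


/-! ### Anatomy of a renewal: the junction edge is vertical, from level `2t-1` to level `2t` -/

/-- `rIdx t (O :: l') = rIdx-of-the-tail + 1` for `t ≥ 1` (the origin is below level `2t`). [folklore] -/
theorem rIdx_cons_hvOrigin {t : ℕ} (ht : 1 ≤ t) (l' : List HV) :
    rIdx t (hvOrigin :: l') = (l'.findIdx fun v => decide (2 * (t : ℤ) ≤ lev v)) + 1 := by
  rw [rIdx, List.findIdx_cons]
  have h0 : decide (2 * (t : ℤ) ≤ lev hvOrigin) = false := by
    rw [lev_hvOrigin, decide_eq_false_iff_not]; omega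
  rw [h0]; rfl

/-- For a bridge and `t ≥ 1`, the low piece is nonempty (it contains the origin).
[cite: MadrasSlade1993, §4.2] -/
theorem low_ne_nil {T L t : ℕ} (hT : 1 ≤ T) (ht : 1 ≤ t) {l : List HV} (hl : l ∈ bridgeLists T L) :
    low t l ≠ [] := by
  obtain ⟨-, hh, -, -, hne, -⟩ := (mem_bridgeLists_iff hT).1 hl
  obtain ⟨l', rfl⟩ : ∃ l', l = hvOrigin :: l' := by
    cases l with
    | nil => exact absurd rfl hne
    | cons a l' => simp only [List.head?_cons, Option.some.injEq] at hh; exact ⟨l', by rw [hh]⟩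
  rw [low, rIdx_cons_hvOrigin ht]
  simp

/-- The head of a bridge's low piece is the origin. [folklore] -/
theorem head?_low {T L t : ℕ} (hT : 1 ≤ T) (ht : 1 ≤ t) {l : List HV} (hl : l ∈ bridgeLists T L) :
    (low t l).head? = some hvOrigin := by
  obtain ⟨-, hh, -, -, -, -⟩ := (mem_bridgeLists_iff hT).1 hl
  have hne := low_ne_nil hT ht hl
  rw [low] at hne ⊢
  rw [List.head?_take]
  split_ifs with h0
  · simp [h0] at hne
  · exact hh

/-- A vertex adjacent to and one level above a type-`1` vertex is the vertex straight above it. [folklore] -/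
theorem eq_upOf_of_adj {v w : HV} (hadj : hvGraph.Adj v w) (hv : v.2.2 = true) (h : lev w = lev v + 1) :
    w = upOf v := by
  obtain ⟨a, b, c⟩ := v
  obtain ⟨a', b', c'⟩ := w
  simp only at hv
  subst hv
  cases c' <;> simp [hvGraph_adj, AdjRel, upOf, lev, bit] at hadj h ⊢
  omega

/-- **The junction of a renewal.**  If the low piece of a chain is nonempty and the high piece is nonempty,
the last low vertex `v` has level `2t-1` (type `1`, second coordinate `t-1`) and the first high vertex is `upOf v`,
on level `2t`. [cite: MadrasSlade1993, §4.2; DuminilCopinSmirnov2012, §3] -/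
theorem junction {t : ℕ} {l : List HV} (hc : l.IsChain hvGraph.Adj) (hlow : low t l ≠ [])
    (hr : rIdx t l < l.length) :
    lev ((low t l).getLast hlow) = 2 * (t : ℤ) - 1 ∧ ((low t l).getLast hlow).2.2 = true ∧
      ((low t l).getLast hlow).2.1 = (t : ℤ) - 1 ∧
      (high t l).head (high_ne_nil_iff.2 hr) = upOf ((low t l).getLast hlow) := by
  have hhigh : high t l ≠ [] := high_ne_nil_iff.2 hr
  have hc' : (low t l ++ high t l).IsChain hvGraph.Adj := by rwa [low_append_high]
  have hadj := hc'.rel_getLast_head_of_append hlow hhigh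
  have hvlt : lev ((low t l).getLast hlow) < 2 * (t : ℤ) := lev_lt_of_mem_low (List.getLast_mem hlow)
  have hwge : 2 * (t : ℤ) ≤ lev ((high t l).head hhigh) := by
    rw [head_high]; exact le_lev_head_high hr
  have hstep := lev_eq_of_adj hadj
  have hv : lev ((low t l).getLast hlow) = 2 * (t : ℤ) - 1 := by omega
  have hw : lev ((high t l).head hhigh) = lev ((low t l).getLast hlow) + 1 := by omega
  have htyp : ((low t l).getLast hlow).2.2 = true := by
    by_contra hf
    rw [Bool.not_eq_true] at hf
    have : lev ((low t l).getLast hlow) = 2 * ((low t l).getLast hlow).2.1 := by simp [lev, bit, hf]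
    omega
  refine ⟨hv, htyp, ?_, eq_upOf_of_adj hadj htyp hw⟩
  have : lev ((low t l).getLast hlow) = 2 * ((low t l).getLast hlow).2.1 + 1 := by simp [lev, bit, htyp]
  omega

/-- The low piece of a bridge at a renewal level `t ≥ 1` is a bridge of width `t` of `S_{t,L}`.
[cite: MadrasSlade1993, §4.2 (4.2.1); Kesten1963SAW, §4] -/
theorem low_mem_bridgeLists {T L t : ℕ} (hT : 1 ≤ T) (ht : 1 ≤ t) {l : List HV} (hl : l ∈ bridgeLists T L)
    (hr : IsRenewalAt t l) : low t l ∈ bridgeLists t L := by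
  obtain ⟨hc, hh, hnd, hV, hne, hlast⟩ := (mem_bridgeLists_iff hT).1 hl
  have hlow := low_ne_nil hT ht hl
  have hc' : (low t l ++ high t l).IsChain hvGraph.Adj := by rwa [low_append_high]
  rw [mem_bridgeLists_iff ht]
  refine ⟨hc'.left_of_append, head?_low hT ht hl, hnd.sublist (List.take_sublist _ _), fun x hx => ?_,
    hlow, (junction hc hlow hr.1).1⟩
  have hxl : x ∈ l := List.mem_of_mem_take hx
  have hxV := hV x hxl
  have hlt := lev_lt_of_mem_low hx
  rw [mem_stripV_iff] at hxV ⊢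
  obtain ⟨a, b, c⟩ := x
  cases c <;> simp [lev, bit] at hxV hlt ⊢ <;> omega

/-- The horizontal coordinate of the junction (the last vertex of the low piece; junk `0` if empty). [folklore] -/
def jx (t : ℕ) (l : List HV) : ℤ := ((low t l).getLastD hvOrigin).1

/-- `jx` is the first coordinate of the last low vertex. [folklore] -/
theorem jx_eq {t : ℕ} {l : List HV} (hlow : low t l ≠ []) : jx t l = ((low t l).getLast hlow).1 := by
  rw [jx, List.getLastD_eq_getLast?, List.getLast?_eq_some_getLast hlow]; rfl

/-- The high piece translated so that it starts at the origin. [cite: Kesten1963SAW, §4; MadrasSlade1993, (1.2.15)] -/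
def highStd (t : ℕ) (l : List HV) : List HV := (high t l).map (shift (-jx t l) (-(t : ℤ)))

/-- A list mapped by a lattice automorphism is a chain iff the list is. [folklore] -/
theorem isChain_map_iso (φ : hvGraph ≃g hvGraph) {l : List HV} :
    (l.map φ).IsChain hvGraph.Adj ↔ l.IsChain hvGraph.Adj := by
  rw [List.isChain_map]
  exact ⟨fun h => h.imp fun a b hab => φ.map_rel_iff.1 hab, fun h => h.imp fun a b hab => φ.map_rel_iff.2 hab⟩

/-- The translated high piece of a bridge of width `T` at a renewal level `1 ≤ t < T` is a bridge of width
`T - t` of `S_{T-t, 2L+T}`. [cite: Kesten1963SAW, §4; MadrasSlade1993, §4.2] -/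
theorem highStd_mem_bridgeLists {T L t : ℕ} (hT : 1 ≤ T) (ht : 1 ≤ t) (htT : t < T) {l : List HV}
    (hl : l ∈ bridgeLists T L) (hr : IsRenewalAt t l) : highStd t l ∈ bridgeLists (T - t) (2 * L + T) := by
  obtain ⟨hc, hh, hnd, hV, hne, hlast⟩ := (mem_bridgeLists_iff hT).1 hl
  have hlow := low_ne_nil hT ht hl
  have hhigh : high t l ≠ [] := high_ne_nil_iff.2 hr.1
  obtain ⟨hvlev, hvtyp, hvx1, hhead⟩ := junction hc hlow hr.1
  have hc' : (low t l ++ high t l).IsChain hvGraph.Adj := by rwa [low_append_high]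
  set v : HV := (low t l).getLast hlow with hvdef
  -- bounds on the junction coordinate
  have hvV : v ∈ stripV T L := hV _ (List.mem_of_mem_take (List.getLast_mem hlow))
  have hbit : bit v = 1 := by simp [bit, hvtyp]
  have hjxv : jx t l = v.1 := jx_eq hlow
  have hjx : -(L : ℤ) - t ≤ jx t l ∧ jx t l ≤ L := by
    rw [mem_stripV_iff] at hvV; rw [hjxv]; omega
  have htT' : ((T - t : ℕ) : ℤ) = T - t := by push_cast [Nat.cast_sub htT.le]; ring
  rw [mem_bridgeLists_iff (by omega), highStd]
  refine ⟨(isChain_map_iso _).2 hc'.right_of_append, ?_,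
    (hnd.sublist (List.drop_sublist _ _)).map (shift _ _).injective, fun x hx => ?_, by simpa using hhigh, ?_⟩
  · -- head = origin
    rw [List.head?_map, List.head?_eq_some_head hhigh, hhead, hjxv]
    simp only [Option.map_some, shift_apply, upOf, hvx1, Option.some.injEq, hvOrigin]
    ext <;> simp
  · -- inside `S_{T-t, 2L+T}`
    rw [List.mem_map] at hx
    obtain ⟨y, hy, rfl⟩ := hx
    have hyl : y ∈ l := List.mem_of_mem_drop hy
    have hyV := hV y hyl
    have hylev : 2 * (t : ℤ) ≤ lev y := hr.2 y hy
    rw [mem_stripV_iff] at hyV ⊢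
    obtain ⟨a, b, c⟩ := y
    cases c <;> simp [lev, bit] at hyV hylev ⊢ <;> push_cast [htT'] <;> omega
  · -- last vertex on the top level `2(T-t) - 1`
    rw [List.getLast_map, lev_shift, getLast_high, hlast, htT']
    ring


/-! ### Renewal levels of a concatenation; the first renewal level -/

/-- If `m₁` reaches a level `≥ 2t'`, then `rIdx t' (m₁ ++ m₂) = rIdx t' m₁`. [folklore] -/
theorem rIdx_append_of_lt {t' : ℕ} {m₁ m₂ : List HV} (h1 : rIdx t' m₁ < m₁.length) :
    rIdx t' (m₁ ++ m₂) = rIdx t' m₁ := by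
  unfold rIdx at h1 ⊢
  rw [List.findIdx_append, if_pos h1]

/-- If `m₁` reaches a level `≥ 2t'`, then `high t' (m₁ ++ m₂) = high t' m₁ ++ m₂`. [folklore] -/
theorem high_append_of_lt {t' : ℕ} {m₁ m₂ : List HV} (h1 : rIdx t' m₁ < m₁.length) :
    high t' (m₁ ++ m₂) = high t' m₁ ++ m₂ := by
  rw [high, rIdx_append_of_lt h1, List.drop_append_of_le_length h1.le]; rfl

/-- If `m₁` reaches a level `≥ 2t'`, then `low t' (m₁ ++ m₂) = low t' m₁`. [folklore] -/
theorem low_append_of_lt {t' : ℕ} {m₁ m₂ : List HV} (h1 : rIdx t' m₁ < m₁.length) :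
    low t' (m₁ ++ m₂) = low t' m₁ := by
  rw [low, rIdx_append_of_lt h1, List.take_append_of_le_length h1.le]; rfl

/-- **Renewal levels of a concatenation** whose first part reaches level `2t'`: `t'` is a renewal level of
`m₁ ++ m₂` iff it is one of `m₁` and `m₂` stays on levels `≥ 2t'`. [cite: MadrasSlade1993, §4.2] -/
theorem isRenewalAt_append_iff {t' : ℕ} {m₁ m₂ : List HV} (h1 : rIdx t' m₁ < m₁.length) :
    IsRenewalAt t' (m₁ ++ m₂) ↔ IsRenewalAt t' m₁ ∧ ∀ v ∈ m₂, 2 * (t' : ℤ) ≤ lev v := by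
  rw [IsRenewalAt, IsRenewalAt, rIdx_append_of_lt h1, high_append_of_lt h1]
  simp only [List.length_append, List.mem_append]
  constructor
  · rintro ⟨-, h⟩
    exact ⟨⟨h1, fun v hv => h v (Or.inl hv)⟩, fun v hv => h v (Or.inr hv)⟩
  · rintro ⟨⟨-, ha⟩, hb⟩
    exact ⟨by omega, fun v hv => hv.elim (ha v) (hb v)⟩

/-- A list whose last vertex is on a level `≥ 2t'` reaches level `2t'`. [folklore] -/
theorem rIdx_lt_length_of_getLast {t' : ℕ} {m : List HV} (hm : m ≠ []) (h : 2 * (t' : ℤ) ≤ lev (m.getLast hm)) :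
    rIdx t' m < m.length :=
  List.findIdx_lt_length_of_exists ⟨m.getLast hm, List.getLast_mem hm, by simpa using h⟩

/-- Decidability of "some `1 ≤ t < T` is a renewal level" (a bounded quantifier). [folklore] -/
instance instDecidableExistsRenewal (T : ℕ) (l : List HV) : Decidable (∃ t, 1 ≤ t ∧ t < T ∧ IsRenewalAt t l) :=
  decidable_of_iff (∃ t ∈ range T, 1 ≤ t ∧ IsRenewalAt t l)
    ⟨fun ⟨t, ht, h1, h2⟩ => ⟨t, h1, mem_range.1 ht, h2⟩, fun ⟨t, h1, h2, h3⟩ => ⟨t, mem_range.2 h2, h1, h3⟩⟩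

/-- The **first renewal level** of a bridge of width `T` (`T` itself if the bridge is irreducible).
[cite: MadrasSlade1993, §4.2; Kesten1963SAW, §4] -/
def firstRen (T : ℕ) (l : List HV) : ℕ :=
  if h : ∃ t, 1 ≤ t ∧ t < T ∧ IsRenewalAt t l then Nat.find h else T

/-- An irreducible bridge has `firstRen = T`. [folklore] -/
theorem firstRen_of_isIrred {T : ℕ} {l : List HV} (h : IsIrred T l) : firstRen T l = T := by
  rw [firstRen, dif_neg]
  rintro ⟨t, h1, h2, h3⟩
  exact h t h1 h2 h3

/-- If `firstRen T l = T` then the bridge is irreducible. [folklore] -/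
theorem isIrred_of_firstRen_eq {T : ℕ} {l : List HV} (h : firstRen T l = T) : IsIrred T l := by
  intro t h1 h2 h3
  have hex : ∃ t, 1 ≤ t ∧ t < T ∧ IsRenewalAt t l := ⟨t, h1, h2, h3⟩
  rw [firstRen, dif_pos hex] at h
  have := (Nat.find_spec hex).2.1
  omega

/-- `firstRen ≤ T`, and `1 ≤ firstRen` when `1 ≤ T`. [folklore] -/
theorem firstRen_le {T : ℕ} (l : List HV) : firstRen T l ≤ T := by
  unfold firstRen
  split_ifs with h
  · exact (Nat.find_spec h).2.1.le
  · exact le_rfl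

/-- `1 ≤ firstRen` when `1 ≤ T`. [folklore] -/
theorem one_le_firstRen {T : ℕ} (hT : 1 ≤ T) (l : List HV) : 1 ≤ firstRen T l := by
  unfold firstRen
  split_ifs with h
  · exact (Nat.find_spec h).1
  · exact hT

/-- If `firstRen T l = t < T` then `t` is a renewal level and no `1 ≤ t' < t` is. [folklore] -/
theorem firstRen_spec {T t : ℕ} {l : List HV} (h : firstRen T l = t) (htT : t < T) :
    IsRenewalAt t l ∧ ∀ t', 1 ≤ t' → t' < t → ¬ IsRenewalAt t' l := by
  unfold firstRen at h
  split_ifs at h with hex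
  · subst h
    refine ⟨(Nat.find_spec hex).2.2, fun t' h1 h2 h3 => ?_⟩
    exact Nat.find_min hex h2 ⟨h1, h2.trans (Nat.find_spec hex).2.1, h3⟩
  · omega

/-- The first renewal level is characterised by: renewal at `t`, none before. [folklore] -/
theorem firstRen_eq_of {T t : ℕ} {l : List HV} (ht : 1 ≤ t) (htT : t < T) (hr : IsRenewalAt t l)
    (hmin : ∀ t', 1 ≤ t' → t' < t → ¬ IsRenewalAt t' l) : firstRen T l = t := by
  have hex : ∃ t, 1 ≤ t ∧ t < T ∧ IsRenewalAt t l := ⟨t, ht, htT, hr⟩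
  rw [firstRen, dif_pos hex]
  apply le_antisymm
  · exact Nat.find_min' hex ⟨ht, htT, hr⟩
  · by_contra hlt
    rw [not_le] at hlt
    exact hmin _ (Nat.find_spec hex).1 hlt (Nat.find_spec hex).2.2

/-- **The low piece at the first renewal level is irreducible.** [cite: MadrasSlade1993, §4.2; Kesten1963SAW, §4] -/
theorem isIrred_low {t : ℕ} {l : List HV} (hr : IsRenewalAt t l)
    (hmin : ∀ t', 1 ≤ t' → t' < t → ¬ IsRenewalAt t' l) : IsIrred t (low t l) := by
  intro t' h1 h2 h3
  apply hmin t' h1 h2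
  have key := (isRenewalAt_append_iff (m₂ := high t l) h3.1).2 ⟨h3, fun v hv => (by
    have := hr.2 v hv; omega)⟩
  rwa [low_append_high] at key

/-! ### Kesten's concatenation of an irreducible bridge with a bridge -/

/-- **Concatenation**: the irreducible bridge `l₁` of width `t` followed by the bridge `l₂`, translated so that it
starts at the vertex above the last vertex of `l₁`. [cite: Kesten1963SAW, §4; MadrasSlade1993, (1.2.15)] -/
def brConcat (t : ℕ) (l₁ l₂ : List HV) : List HV := l₁ ++ l₂.map (shift (l₁.getLastD hvOrigin).1 t)

/-- In a bridge of width `t`, no vertex is on a level `≥ 2t`: `rIdx t = length`. [folklore] -/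
theorem rIdx_eq_length_of_mem_bridgeLists {t L : ℕ} (ht : 1 ≤ t) {l₁ : List HV} (h : l₁ ∈ bridgeLists t L) :
    rIdx t l₁ = l₁.length := by
  rw [rIdx, List.findIdx_eq_length]
  intro x hx
  obtain ⟨-, -, -, hV, -⟩ := (mem_bridgeLists_iff ht).1 h
  have := (lev_mem_of_mem_stripV (hV x hx)).2
  simp only [decide_eq_false_iff_not, not_le]
  omega

/-- Anatomy of the last vertex of a bridge of width `t`: level `2t-1`, type `1`, second coordinate `t-1`,
first coordinate in `[-L-t, L]`. [cite: DuminilCopinSmirnov2012, §3] -/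
theorem getLast_bridge {t L : ℕ} (ht : 1 ≤ t) {l₁ : List HV} (h : l₁ ∈ bridgeLists t L) (hne : l₁ ≠ []) :
    lev (l₁.getLast hne) = 2 * (t : ℤ) - 1 ∧ (l₁.getLast hne).2.2 = true ∧ (l₁.getLast hne).2.1 = (t : ℤ) - 1 ∧
      -(L : ℤ) - t ≤ (l₁.getLast hne).1 ∧ (l₁.getLast hne).1 ≤ L := by
  obtain ⟨-, -, -, hV, hne', hlast'⟩ := (mem_bridgeLists_iff ht).1 h
  have hlast : lev (l₁.getLast hne) = 2 * (t : ℤ) - 1 := hlast'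
  have hV' := hV _ (List.getLast_mem hne)
  rw [mem_stripV_iff] at hV'
  set v : HV := l₁.getLast hne with hv
  clear_value v
  obtain ⟨a, b, c⟩ := v
  cases c <;> simp [lev, bit] at hlast hV' ⊢ <;> omega

/-- `rIdx t (brConcat t l₁ l₂) = |l₁|`: the translated `l₂` starts on level `2t`. [cite: Kesten1963SAW, §4] -/
theorem rIdx_brConcat {t T L : ℕ} (ht : 1 ≤ t) (htT : t < T) {l₁ l₂ : List HV} (h₁ : l₁ ∈ bridgeLists t L)
    (h₂ : l₂ ∈ bridgeLists (T - t) L) : rIdx t (brConcat t l₁ l₂) = l₁.length := by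
  rw [brConcat, rIdx, List.findIdx_append, if_neg (by rw [← rIdx, rIdx_eq_length_of_mem_bridgeLists ht h₁]; omega)]
  obtain ⟨-, hh, -, -, hne, -⟩ := (mem_bridgeLists_iff (by omega)).1 h₂
  obtain ⟨m, rfl⟩ : ∃ m, l₂ = hvOrigin :: m := by
    cases l₂ with
    | nil => exact absurd rfl hne
    | cons a m => simp only [List.head?_cons, Option.some.injEq] at hh; exact ⟨m, by rw [hh]⟩
  rw [List.map_cons, List.findIdx_cons]
  have : decide (2 * (t : ℤ) ≤ lev (shift (l₁.getLastD hvOrigin).1 t hvOrigin)) = true := by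
    rw [lev_shift, lev_hvOrigin, decide_eq_true_eq]; omega
  rw [this]; simp

/-- `low t (brConcat t l₁ l₂) = l₁`. [cite: Kesten1963SAW, §4] -/
theorem low_brConcat {t T L : ℕ} (ht : 1 ≤ t) (htT : t < T) {l₁ l₂ : List HV} (h₁ : l₁ ∈ bridgeLists t L)
    (h₂ : l₂ ∈ bridgeLists (T - t) L) : low t (brConcat t l₁ l₂) = l₁ := by
  rw [low, rIdx_brConcat ht htT h₁ h₂, brConcat, List.take_left]

/-- `high t (brConcat t l₁ l₂)` is the translated `l₂`. [cite: Kesten1963SAW, §4] -/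
theorem high_brConcat {t T L : ℕ} (ht : 1 ≤ t) (htT : t < T) {l₁ l₂ : List HV} (h₁ : l₁ ∈ bridgeLists t L)
    (h₂ : l₂ ∈ bridgeLists (T - t) L) :
    high t (brConcat t l₁ l₂) = l₂.map (shift (l₁.getLastD hvOrigin).1 t) := by
  rw [high, rIdx_brConcat ht htT h₁ h₂, brConcat, List.drop_left]

/-- `t` is a renewal level of `brConcat t l₁ l₂`. [cite: Kesten1963SAW, §4] -/
theorem isRenewalAt_brConcat {t T L : ℕ} (ht : 1 ≤ t) (htT : t < T) {l₁ l₂ : List HV} (h₁ : l₁ ∈ bridgeLists t L)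
    (h₂ : l₂ ∈ bridgeLists (T - t) L) : IsRenewalAt t (brConcat t l₁ l₂) := by
  obtain ⟨-, -, -, hV, hne, -⟩ := (mem_bridgeLists_iff (by omega : 1 ≤ T - t)).1 h₂
  refine ⟨?_, fun v hv => ?_⟩
  · rw [rIdx_brConcat ht htT h₁ h₂, brConcat, List.length_append, List.length_map]
    have : 0 < l₂.length := List.length_pos_iff.2 hne
    omega
  · rw [high_brConcat ht htT h₁ h₂, List.mem_map] at hv
    obtain ⟨y, hy, rfl⟩ := hv
    have := (lev_mem_of_mem_stripV (hV y hy)).1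
    rw [lev_shift]; omega

/-- `brConcat t l₁ l₂` is a bridge of width `T` of `S_{T, 2L+T}` (`l₁` a bridge of width `t ≥ 1` of `S_{t,L}`, `l₂` one of
width `T - t ≥ 1` of `S_{T-t,L}`). [cite: Kesten1963SAW, §4; MadrasSlade1993, (1.2.15)] -/
theorem brConcat_mem_bridgeLists {t T L : ℕ} (ht : 1 ≤ t) (htT : t < T) {l₁ l₂ : List HV} (h₁ : l₁ ∈ bridgeLists t L)
    (h₂ : l₂ ∈ bridgeLists (T - t) L) : brConcat t l₁ l₂ ∈ bridgeLists T (2 * L + T) := by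
  obtain ⟨hc₁, hh₁, hnd₁, hV₁, hne₁, -⟩ := (mem_bridgeLists_iff ht).1 h₁
  obtain ⟨hc₂, hh₂, hnd₂, hV₂, hne₂, hlast₂⟩ := (mem_bridgeLists_iff (by omega : 1 ≤ T - t)).1 h₂
  obtain ⟨hvlev, hvtyp, hvx1, hvlo, hvhi⟩ := getLast_bridge ht h₁ hne₁
  have hD : l₁.getLastD hvOrigin = l₁.getLast hne₁ := by
    rw [List.getLastD_eq_getLast?, List.getLast?_eq_some_getLast hne₁]; rfl
  have hMne : l₂.map (shift (l₁.getLastD hvOrigin).1 t) ≠ [] := by simpa using hne₂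
  have hheadM : (l₂.map (shift (l₁.getLastD hvOrigin).1 t)).head? = some (upOf (l₁.getLast hne₁)) := by
    rw [List.head?_map, hh₂, hD]
    simp only [Option.map_some, Option.some.injEq, shift_apply, upOf, hvx1]
    ext <;> simp [hvOrigin]
  have htT' : ((T - t : ℕ) : ℤ) = T - t := by push_cast [Nat.cast_sub htT.le]; ring
  rw [mem_bridgeLists_iff (by omega)]
  refine ⟨?_, ?_, ?_, fun x hx => ?_, by simp [brConcat, hne₁], ?_⟩
  · -- chain
    refine List.IsChain.append hc₁ ((isChain_map_iso _).2 hc₂) fun x hx y hy => ?_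
    rw [List.getLast?_eq_some_getLast hne₁, Option.mem_def, Option.some_inj] at hx
    rw [hheadM, Option.mem_def, Option.some_inj] at hy
    subst hx; subst hy
    set v : HV := l₁.getLast hne₁ with hv
    clear_value v
    obtain ⟨a, b, c⟩ := v
    simp only at hvtyp
    subst hvtyp
    simp [upOf, hvGraph_adj, AdjRel]
  · -- head
    rw [brConcat, List.head?_append, hh₁]; rfl
  · -- nodup: levels of `l₁` are `< 2t ≤` levels of the translated `l₂`
    rw [brConcat, List.nodup_append]
    refine ⟨hnd₁, hnd₂.map (shift _ _).injective, fun a ha b hb hab => ?_⟩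
    have ha' := (lev_mem_of_mem_stripV (hV₁ a ha)).2
    rw [List.mem_map] at hb
    obtain ⟨y, hy, rfl⟩ := hb
    have hy' := (lev_mem_of_mem_stripV (hV₂ y hy)).1
    have := congrArg lev hab
    rw [lev_shift] at this
    omega
  · -- inside `S_{T, 2L+T}`
    rw [brConcat, List.mem_append] at hx
    rcases hx with hx | hx
    · have := hV₁ x hx
      rw [mem_stripV_iff] at this ⊢
      push_cast; omega
    · rw [List.mem_map] at hx
      obtain ⟨y, hy, rfl⟩ := hx
      have hyV := hV₂ y hy
      rw [hD]
      rw [mem_stripV_iff] at hyV ⊢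
      obtain ⟨a, b, c⟩ := y
      cases c <;> simp [lev, bit] at hyV ⊢ <;> push_cast [htT'] at hyV ⊢ <;> omega
  · -- last vertex on level `2T - 1`
    have h1 : (brConcat t l₁ l₂).getLast (by simp [brConcat, hne₁]) =
        (l₂.map (shift (l₁.getLastD hvOrigin).1 t)).getLast hMne :=
      List.getLast_append_of_ne_nil _ hMne
    rw [h1, List.getLast_map, lev_shift, hlast₂, htT']
    ring

/-- The first renewal level of `brConcat t l₁ l₂` is `t` when `l₁` is irreducible. [cite: Kesten1963SAW, §4] -/
theorem firstRen_brConcat {t T L : ℕ} (ht : 1 ≤ t) (htT : t < T) {l₁ l₂ : List HV} (h₁ : l₁ ∈ irrLists t L)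
    (h₂ : l₂ ∈ bridgeLists (T - t) L) : firstRen T (brConcat t l₁ l₂) = t := by
  rw [irrLists, mem_filter] at h₁
  refine firstRen_eq_of ht htT (isRenewalAt_brConcat ht htT h₁.1 h₂) fun t' h1 h2 h3 => ?_
  obtain ⟨-, -, -, -, hne₁, hlast₁⟩ := (mem_bridgeLists_iff ht).1 h₁.1
  have hr1 : rIdx t' l₁ < l₁.length := rIdx_lt_length_of_getLast hne₁ (by rw [hlast₁]; omega)
  exact h₁.2 t' h1 h2 ((isRenewalAt_append_iff hr1).1 h3).1

/-- **Unique decoding**: `brConcat t` is injective on (bridges of width `t`) × (bridges of width `T-t`).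
[cite: Kesten1963SAW, §4; MadrasSlade1993, §4.2] -/
theorem brConcat_injOn {t T L : ℕ} (ht : 1 ≤ t) (htT : t < T) :
    Set.InjOn (fun p : List HV × List HV => brConcat t p.1 p.2) ↑(bridgeLists t L ×ˢ bridgeLists (T - t) L) := by
  rintro ⟨l₁, l₂⟩ hp ⟨l₁', l₂'⟩ hp' heq
  simp only [coe_product, Set.mem_prod, mem_coe] at hp hp'
  dsimp only at heq
  have e1 : l₁ = l₁' := by
    rw [← low_brConcat ht htT hp.1 hp.2, ← low_brConcat ht htT hp'.1 hp'.2, heq]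
  subst e1
  have e2 := high_brConcat ht htT hp.1 hp.2
  rw [heq, high_brConcat ht htT hp'.1 hp'.2] at e2
  exact Prod.ext rfl ((List.map_injective_iff.2 (shift _ _).injective) e2.symm)


/-! ### The lower renewal inequality (finite volume) -/

/-- `bridgeLists` is monotone in `L`. [cite: DuminilCopinSmirnov2012, §3] -/
theorem bridgeLists_mono_L {T L L' : ℕ} (hT : 1 ≤ T) (h : L ≤ L') : bridgeLists T L ⊆ bridgeLists T L' := by
  intro l hl
  rw [mem_bridgeLists_iff hT] at hl ⊢
  obtain ⟨hc, hh, hnd, hV, hne, hlast⟩ := hl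
  exact ⟨hc, hh, hnd, fun x hx => stripV_mono_L h (hV x hx), hne, hlast⟩

/-- `firstRen T` takes values in `[1, T]` (for `T ≥ 1`). [folklore] -/
theorem firstRen_mem_Icc {T : ℕ} (hT : 1 ≤ T) (l : List HV) : firstRen T l ∈ Icc 1 T :=
  mem_Icc.2 ⟨one_le_firstRen hT l, firstRen_le l⟩

/-- `|brConcat t l₁ l₂| = |l₁| + |l₂|`. [folklore] -/
theorem length_brConcat (t : ℕ) (l₁ l₂ : List HV) : (brConcat t l₁ l₂).length = l₁.length + l₂.length := by
  simp [brConcat]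

/-- `B_{T,L}` decomposed along the first renewal level. [cite: Kesten1963SAW, §4 (proof)] -/
theorem stripB_eq_sum_firstRen {T : ℕ} (hT : 1 ≤ T) (L : ℕ) (x : ℝ) :
    stripB T L x = ∑ t ∈ Icc 1 T, ∑ l ∈ bridgeLists T L with firstRen T l = t, x ^ l.length := by
  rw [stripB_eq_sum_bridgeLists hT, sum_fiberwise_of_maps_to (fun l _ => firstRen_mem_Icc hT l)]

/-- A sum over `Icc 1 T` is the sum over `Ico 1 T` plus the term at `T` (`T ≥ 1`). [folklore] -/
theorem sum_Icc_eq_sum_Ico_add {T : ℕ} (hT : 1 ≤ T) (F : ℕ → ℝ) :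
    ∑ t ∈ Icc 1 T, F t = ∑ t ∈ Ico 1 T, F t + F T := by
  rw [← Finset.Ico_add_one_right_eq_Icc, sum_Ico_succ_top hT]

/-- **The lower renewal inequality** (Kesten's concatenation, finite volume): for `T ≥ 1` and `x ≥ 0`,
`I_{T,L}(x) + Σ_{1 ≤ t < T} I_{t,L}(x) · B_{T-t,L}(x) ≤ B_{T,2L+T}(x)` — an irreducible bridge of width `t` of
`S_{t,L}` followed by a bridge of width `T-t` of `S_{T-t,L}` is a bridge of width `T` of `S_{T,2L+T}` with first
renewal level `t`, injectively. [cite: Kesten1963SAW, §4; MadrasSlade1993, (4.2.2)] -/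
theorem sum_brConcat_le_stripB {T : ℕ} (hT : 1 ≤ T) (L : ℕ) {x : ℝ} (hx : 0 ≤ x) :
    stripI T L x + ∑ t ∈ Ico 1 T, stripI t L x * stripB (T - t) L x ≤ stripB T (2 * L + T) x := by
  have hL : L ≤ 2 * L + T := by omega
  rw [stripB_eq_sum_firstRen hT (2 * L + T), sum_Icc_eq_sum_Ico_add hT, add_comm]
  refine add_le_add (sum_le_sum fun t ht => ?_) ?_
  · -- the terms `1 ≤ t < T`: concatenation
    rw [mem_Ico] at ht
    have ht1 : 1 ≤ t := ht.1
    have htT : t < T := ht.2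
    rw [stripI, stripB_eq_sum_bridgeLists (by omega : 1 ≤ T - t), sum_mul_sum, ← sum_product']
    have heq : ∀ p ∈ irrLists t L ×ˢ bridgeLists (T - t) L,
        x ^ p.1.length * x ^ p.2.length = x ^ (brConcat t p.1 p.2).length := fun p _ => by
      rw [length_brConcat, pow_add]
    rw [sum_congr rfl heq]
    refine sum_le_sum_of_injOn_of_nonneg (fun p : List HV × List HV => brConcat t p.1 p.2) ?_ ?_
      (fun l => x ^ l.length) (fun _ _ => pow_nonneg hx _)
    · refine (brConcat_injOn (L := L) ht1 htT).mono ?_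
      rw [coe_product, coe_product]
      exact Set.prod_mono (by rw [irrLists]; exact coe_subset.2 (filter_subset _ _)) le_rfl
    · rintro ⟨l₁, l₂⟩ hp
      rw [mem_product] at hp
      have h₁ : l₁ ∈ bridgeLists t L := (mem_filter.1 hp.1).1
      rw [mem_filter]
      exact ⟨brConcat_mem_bridgeLists ht1 htT h₁ hp.2, firstRen_brConcat ht1 htT hp.1 hp.2⟩
  · -- the term `t = T`: irreducible bridges themselves
    rw [stripI]
    refine sum_le_sum_of_subset_of_nonneg (fun l hl => ?_) fun _ _ _ => pow_nonneg hx _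
    rw [irrLists, mem_filter] at hl
    rw [mem_filter]
    exact ⟨bridgeLists_mono_L hT hL hl.1, firstRen_of_isIrred hl.2⟩

end HV

end Literature.Probability.RandomPlanarGeometry.SAW

end
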